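import Literature.Analysis.FluidPDE.KNSSTypeIRateCoreProofs
import Literature.Analysis.FluidPDE.KNSSBlowupLimit
import Literature.Analysis.FluidPDE.HolderExtraction
import Literature.Analysis.FluidPDE.OseenMildHolder
import Literature.Analysis.FluidPDE.OseenDuhamelLimits
import HarnessLib

/-!
# KNSS 2009, Lemma 6.1 for the doubly rescaled sequence: the compactness fact from the
# mildness clause of Theorem 6.1 (proved reduction)

Analysis/FluidPDE proof file for `Literature.Analysis.FluidPDE.KNSS2009_typeI_rate_compactness`
(`KNSSTypeIRateCore.lean`; Koch–Nadirashvili–Seregin–Šverák, Acta Math. 203 (2009) =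
arXiv:0709.3599, Lemma 6.1 p. 11 as used in the proof of Theorem 6.2, p. 13). It proves

* `KNSS2009_typeI_rate_compactness_of_oseenMild :
    KNSS2009_oseenMild_of_cylRadius_decay → KNSS2009_typeI_rate_compactness`,

i.e. the whole compactness statement from the single residual hypothesis "bounded classical
solutions with the horizontal decay (6.4) satisfy the Oseen integral equation between all pairs
of interior times" — the mildness clause of KNSS's Theorem 6.1 (p. 11: "Moreover, `u` is a mild
solution", proved on p. 12 from Lemma 3.1: "It follows easily that `b` must vanish and therefore
`u` is a mild solution"), written out here verbatim and vendored as the named fact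
`KNSS2009_oseenMild_of_cylRadius_decay` in the sibling facts file `KNSSOseenMildDecay.lean`
(which restates the present theorem over that name). Everything else — KNSS's "easy
consequence of the results in Section 4" — is proved here along the following lines (the
source's Lemma 4.1 invokes the smoothing estimates (4.5); equicontinuity with constants depending
on the bound is all that is needed and is obtained by elementary means):

1. each `w⁽ᵏ⁾` is continuous on its slab, bounded by `C/√(−τ)` at negative times ((wkbound3)),
   and — by the named fact, fed with the bound on `(A_k, 0]` and the decay
   `ρ_k(x)‖w⁽ᵏ⁾‖ ≤ K M_k` extracted from (wkbound2) — satisfies the Oseen identity between all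
   times `A_k < s < t < 0`;
2. on the compact pieces `[−(n+2), −1/(n+2)] × B̄(0, n+2)` (`slabPiece`) the `w⁽ᵏ⁾`, `k` large,
   are bounded by `C√(n+2)` and uniformly `1/4`-Hölder (`exists_holder_quarter_of_oseenMild`,
   `OseenMildHolder.lean`);
3. the diagonal Arzelà–Ascoli extraction (`exists_strictMono_tendstoUniformlyOn_of_bound`,
   `HolderExtraction.lean`) gives `φ` and `W` with `w⁽ᵠ⁽ʲ⁾⁾ → W` uniformly on every piece, hence
   `W` continuous on the open slab, pointwise convergence, and slice-wise locally uniform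
   convergence;
4. the bound `√(−t)‖W‖ ≤ C` and weak divergence-freeness pass to the limit (dominated
   convergence against `∇θ`, the slices of the classical `w⁽ᵏ⁾` being divergence free);
5. the Oseen identity passes to the limit pointwise (`tendsto_heatExtension_of_tendsto_of_bound`,
   `tendsto_oseenDuhamel_of_tendsto_of_bound`, `OseenDuhamelLimits.lean`).

With the glue of `KNSSTypeIRateCoreProofs` this makes Theorem 6.2 depend, beyond Theorem 6.1,
on the mildness clause, the Liouville step and the vertex estimate only (the corollary is
recorded in `KNSSOseenMildDecay.lean`).

## References

* G. Koch, N. Nadirashvili, G. Seregin, V. Šverák, *Liouville theorems for the Navier–Stokes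
  equations and applications*, Acta Math. 203 (2009) 83–105 = arXiv:0709.3599: Lemma 4.1 (p. 8),
  Lemma 6.1 (p. 11), Thm. 6.1 and its proof (pp. 11–12), proof of Thm. 6.2 (p. 13).
  [KochNadirashviliSereginSverak2009]
-/

noncomputable section

open MeasureTheory Set Function Filter TopologicalSpace Metric
open _root_.Topology
open scoped RealInnerProductSpace NNReal ENNReal

namespace Literature.Analysis.FluidPDE

/-- Elementary: `C/√(−τ) ≤ C/√δ` for `τ ≤ −δ < 0`, `0 ≤ C`. [folklore] -/
theorem div_sqrt_neg_le {C δ τ : ℝ} (hC : 0 ≤ C) (hδ : 0 < δ) (hτ : τ ≤ -δ) :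
    C / Real.sqrt (-τ) ≤ C / Real.sqrt δ :=
  div_le_div_of_nonneg_left hC (Real.sqrt_pos.2 hδ) (Real.sqrt_le_sqrt (by linarith))

/-- **KNSS 2009, Lemma 6.1 for the doubly rescaled sequence, from the mildness clause of
Theorem 6.1**: the compactness fact `KNSS2009_typeI_rate_compactness` follows from the
hypothesis that bounded classical solutions (`ν = 1`) on `ℝ³ × (a, b)` with the horizontal decay
`cylRadius (x − c) ‖u(t, x)‖ ≤ D` satisfy the Oseen integral equation
`u(t) = e^{(t−s)Δ}u(s) − B¹_s(u,u)(t)` between all interior times (KNSS Thm. 6.1, mildness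
clause, pp. 11–12; the named fact `KNSS2009_oseenMild_of_cylRadius_decay` of
`KNSSOseenMildDecay.lean`, written out), by the equicontinuity of bounded solutions of the
Oseen equation, a diagonal Arzelà–Ascoli extraction and dominated convergence in the integral
equation (module docstring, steps 1–5). [cite: KochNadirashviliSereginSverak2009, Lemma 6.1 (arXiv p. 11) and proof of Thm 6.2 (p. 13)] -/
theorem KNSS2009_typeI_rate_compactness_of_oseenMild
    (hA : ∀ ⦃a b : ℝ⦄ ⦃u : ℝ → (EuclideanSpace ℝ (Fin 3)) → (EuclideanSpace ℝ (Fin 3))⦄ ⦃p : ℝ → (EuclideanSpace ℝ (Fin 3)) → ℝ⦄,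
      IsClassicalNSSolutionOn (Ioo a b) 1 0 u p →
      (∃ L : ℝ, ∀ t ∈ Ioo a b, ∀ x, ‖u t x‖ ≤ L) →
      (∃ (c : (EuclideanSpace ℝ (Fin 3))) (D : ℝ), ∀ t ∈ Ioo a b, ∀ x, cylRadius (x - c) * ‖u t x‖ ≤ D) →
      ∀ s t : ℝ, a < s → s < t → t < b → ∀ x,
        u t x = UnboundedOperators.heatExtension (u s) (t - s) x - oseenDuhamel 1 s u u t x) :
    KNSS2009_typeI_rate_compactness := by
  intro C K M A B w q hC hK hMpos hMlim hAlim hBpos hw hL hI hmul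
  -- ## Step 1: per-`k` facts
  have hcont : ∀ k, ContinuousOn (uncurry (w k)) (Ioo (A k) (B k) ×ˢ univ) := fun k =>
    (hw k).smooth_velocity.continuousOn
  have hslice : ∀ k, ∀ t ∈ Ioo (A k) (B k), Continuous (w k t) := fun k t ht =>
    (hcont k).comp_continuous (Continuous.prodMk_right t) fun x => ⟨ht, mem_univ x⟩
  have hbdd : ∀ k, ∀ τ ∈ Ioo (A k) 0, ∀ x, ‖w k τ x‖ ≤ C / Real.sqrt (-τ) := by
    intro k τ hτ x
    have hs : 0 < Real.sqrt (-τ) := Real.sqrt_pos.2 (neg_pos.2 hτ.2)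
    rw [le_div_iff₀ hs, mul_comm]
    exact hI k τ hτ x
  have hmild : ∀ k, ∀ s t : ℝ, A k < s → s < t → t < 0 → ∀ x,
      w k t x = UnboundedOperators.heatExtension (w k s) (t - s) x - oseenDuhamel 1 s (w k) (w k) t x := by
    intro k
    have hcl : IsClassicalNSSolutionOn (Ioo (A k) 0) 1 0 (w k) (q k) :=
      (hw k).mono (Ioo_subset_Ioo_right (hBpos k).le) (uniqueDiffOn_Ioo _ _)
    refine hA hcl ?_ ?_
    · obtain ⟨L, hL'⟩ := hL k
      exact ⟨L, fun t ht x => hL' t ⟨ht.1, ht.2.le⟩ x⟩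
    · refine ⟨EuclideanSpace.single 0 (-M k), K * M k, fun t ht x => ?_⟩
      have h := hmul k t ⟨ht.1, ht.2.le⟩ x
      have h1 : 0 ≤ ‖w k t x‖ * (M k * Real.sqrt (-t)) := by
        have := (hMpos k).le; positivity
      calc cylRadius (x - EuclideanSpace.single 0 (-M k)) * ‖w k t x‖
          = ‖w k t x‖ * cylRadius (x - EuclideanSpace.single 0 (-M k)) := mul_comm _ _
        _ ≤ ‖w k t x‖ * (M k * Real.sqrt (-t) + cylRadius (x - EuclideanSpace.single 0 (-M k))) := by
            rw [mul_add]; linarith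
        _ ≤ K * M k := h
  -- ## Step 2: the uniform Hölder modulus on the slab pieces
  obtain ⟨K₀, hK₀, hHold⟩ := exists_holder_quarter_of_oseenMild (E := (EuclideanSpace ℝ (Fin 3)))
  -- bound and modulus constant on the `n`-th piece
  set R : ℕ → ℝ := fun n => C / Real.sqrt (1 / ((n : ℝ) + 2)) with hR
  have hR0 : ∀ n, 0 ≤ R n := fun n => by rw [hR]; positivity
  set V : ℕ → ℝ × (EuclideanSpace ℝ (Fin 3)) → (EuclideanSpace ℝ (Fin 3)) := fun k z => w k z.1 z.2 with hV
  -- the slab pieces `[−(n+2), −1/(n+2)] × B̄(0, n+2)` of `HolderExtraction.lean`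
  set T : ℕ → Set (ℝ × (EuclideanSpace ℝ (Fin 3))) := fun n =>
    Icc (-((n : ℝ) + 2)) (-(1 / ((n : ℝ) + 2))) ×ˢ closedBall (0 : (EuclideanSpace ℝ (Fin 3))) ((n : ℝ) + 2) with hT
  have hVn : ∀ n : ℕ, ∀ᶠ k in atTop, ContinuousOn (V k) (T n) ∧
      (∀ z ∈ T n, ‖V k z‖ ≤ R n) ∧
      ∀ z ∈ T n, ∀ z' ∈ T n,
        dist (V k z) (V k z') ≤ K₀ * (R n + R n ^ 2) * dist z z' ^ (1 / 4 : ℝ) := by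
    intro n
    have hn2 : (0 : ℝ) < (n : ℝ) + 2 := by positivity
    have hδ : (0 : ℝ) < 1 / ((n : ℝ) + 2) := by positivity
    filter_upwards [hAlim.eventually (eventually_lt_atBot (-((n : ℝ) + 3)))] with k hk
    -- the window `[a, b] = [−(n+3), −1/(n+2)] ⊂ (A k, 0)`
    set a : ℝ := -((n : ℝ) + 3) with ha
    set b : ℝ := -(1 / ((n : ℝ) + 2)) with hb
    have hb0 : b < 0 := by rw [hb]; linarith
    have hIcc : ∀ t ∈ Icc a b, t ∈ Ioo (A k) (B k) := fun t ht =>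
      ⟨hk.trans_le ht.1, (ht.2.trans_lt hb0).trans (hBpos k)⟩
    have hIcc0 : ∀ t ∈ Icc a b, t ∈ Ioo (A k) 0 := fun t ht => ⟨hk.trans_le ht.1, ht.2.trans_lt hb0⟩
    have hbR : ∀ t ∈ Icc a b, ∀ x, ‖w k t x‖ ≤ R n := fun t ht x =>
      (hbdd k t (hIcc0 t ht) x).trans (div_sqrt_neg_le hC.le hδ (by rw [hb] at ht; exact ht.2))
    have hmod := hHold (hR0 n) (fun t ht => hslice k t (hIcc t ht)) hbR
      (fun s t has hst htb x => hmild k s t (hk.trans_le has) hst (htb.trans_lt hb0) x)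
    have hpiece : ∀ z ∈ T n, z.1 ∈ Icc (a + 1) b := fun z hz => by
      obtain ⟨⟨h1, h2⟩, -⟩ := mem_slabPiece.1 hz
      exact ⟨by rw [ha]; linarith, by rw [hb]; exact h2⟩
    refine ⟨?_, fun z hz => ?_, fun z hz z' hz' => ?_⟩
    · refine (hcont k).mono fun z hz => ⟨?_, mem_univ _⟩
      have h := hpiece z hz
      exact hIcc z.1 ⟨by linarith [h.1], h.2⟩
    · have h := hpiece z hz
      exact hbR z.1 ⟨by linarith [h.1], h.2⟩ z.2
    · have h := hmod z'.1 (hpiece z' hz') z.1 (hpiece z hz) z'.2 z.2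
      rw [dist_eq_norm, Prod.dist_eq, Real.dist_eq, dist_eq_norm]
      exact h
  -- ## Step 3: extraction
  obtain ⟨φ, hφ, W₀, hW₀⟩ := exists_strictMono_tendstoUniformlyOn_of_bound
    (fun n => isCompact_slabPiece (E := (EuclideanSpace ℝ (Fin 3))) n) (fun n => by positivity) (fun _ => by norm_num) hVn
  have hφt : Tendsto φ atTop atTop := hφ.tendsto_atTop
  have hθA : Tendsto (fun j => A (φ j)) atTop atBot := hAlim.comp hφt
  set W : ℝ → (EuclideanSpace ℝ (Fin 3)) → (EuclideanSpace ℝ (Fin 3)) := fun t x => W₀ (t, x) with hWdef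
  have hVφ : ∀ n, ∀ᶠ j in atTop, ContinuousOn (V (φ j)) (T n) := fun n =>
    (hφt.eventually (hVn n)).mono fun j hj => hj.1
  -- continuity of the limit on the open slab
  have hWc : ContinuousOn (uncurry W) (Iio 0 ×ˢ univ) := by
    have h := continuousOn_slab_of_tendstoUniformlyOn hVφ hW₀
    exact h.congr fun z _ => rfl
  -- pointwise convergence at negative times
  have hpt : ∀ t < 0, ∀ x, Tendsto (fun j => w (φ j) t x) atTop (𝓝 (W t x)) := fun t ht x =>
    tendsto_of_tendstoUniformlyOn_slabPiece hW₀ ht x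
  -- eventually the slice lies in the domain
  have hdom : ∀ t : ℝ, ∀ᶠ j in atTop, A (φ j) < t := fun t => hθA.eventually (eventually_lt_atBot t)
  refine ⟨φ, W, hφ, hWc, fun t ht => ?_, fun t ht x => ?_, fun s t hst ht x => ?_, fun t ht => ?_⟩
  · -- ## Step 4a: weak divergence-freeness of the limit slices
    intro θ hθ
    have hθ1 : ContDiff ℝ 1 θ := contDiff_infty.1 hθ.contDiff 1
    have hgc : HasCompactSupport (gradient θ) := by
      have : gradient θ = (fun L => (InnerProductSpace.toDual ℝ (EuclideanSpace ℝ (Fin 3))).symm L) ∘ fderiv ℝ θ := rfl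
      rw [this]
      exact (hθ.hasCompactSupport.fderiv (𝕜 := ℝ)).comp_left (by simp)
    set Mt : ℝ := C / Real.sqrt (-t) with hMt
    have hθi : Integrable (fun x => Mt * ‖gradient θ x‖) volume :=
      (((continuous_gradient_of_contDiff hθ1).integrable_of_hasCompactSupport hgc).norm).const_mul Mt
    have hWslice : Continuous (W t) :=
      hWc.comp_continuous (continuous_const.prodMk continuous_id) fun x => ⟨ht, mem_univ x⟩
    have hlimθ : Tendsto (fun j => ∫ x, ⟪w (φ j) t x, gradient θ x⟫) atTop
        (𝓝 (∫ x, ⟪W t x, gradient θ x⟫)) := by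
      refine tendsto_integral_filter_of_dominated_convergence (fun x => Mt * ‖gradient θ x‖)
        ?_ ?_ hθi (Eventually.of_forall fun x => (hpt t ht x).inner tendsto_const_nhds)
      · filter_upwards [hdom t] with j hj
        exact ((hslice (φ j) t ⟨hj, ht.trans (hBpos _)⟩).inner
          (continuous_gradient_of_contDiff hθ1)).aestronglyMeasurable
      · filter_upwards [hdom t] with j hj
        exact Eventually.of_forall fun x => (norm_inner_le_norm _ _).trans
          (mul_le_mul_of_nonneg_right (hbdd (φ j) t ⟨hj, ht⟩ x) (norm_nonneg _))
    have hzero : ∀ᶠ j in atTop, ∫ x, ⟪w (φ j) t x, gradient θ x⟫ = 0 := by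
      filter_upwards [hdom t] with j hj
      have htj : t ∈ Ioo (A (φ j)) (B (φ j)) := ⟨hj, ht.trans (hBpos _)⟩
      exact VectorCalculus.IsDivFree.isWeaklyDivFree_holds ((hw (φ j)).divFree t htj)
        (contDiff_infty.1 ((hw (φ j)).contDiff_velocity htj) 1) θ hθ
    exact tendsto_nhds_unique hlimθ (tendsto_const_nhds.congr' (hzero.mono fun j hj => hj.symm))
  · -- ## Step 4b: the bound `√(−t)‖W‖ ≤ C`
    refine le_of_tendsto ((hpt t ht x).norm.const_mul (Real.sqrt (-t))) ?_
    filter_upwards [hdom t] with j hj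
    exact hI (φ j) t ⟨hj, ht⟩ x
  · -- ## Step 5: the Oseen identity in the limit
    have hs0 : s < 0 := hst.trans ht
    obtain ⟨k₀, hk₀⟩ := eventually_atTop.1 (hdom s)
    set u : ℕ → ℝ → (EuclideanSpace ℝ (Fin 3)) → (EuclideanSpace ℝ (Fin 3)) := fun j => w (φ (j + k₀)) with hu
    have hAu : ∀ j, A (φ (j + k₀)) < s := fun j => hk₀ _ (Nat.le_add_left _ _)
    have hshift : Tendsto (fun j => j + k₀) atTop atTop := tendsto_add_atTop_nat k₀
    -- bound on `(s, t)`
    set M₀ : ℝ := C / Real.sqrt (-t) with hM₀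
    have hM₀0 : 0 ≤ M₀ := by rw [hM₀]; have := hC.le; positivity
    have huM : ∀ j, ∀ τ ∈ Ioo s t, ∀ y, ‖u j τ y‖ ≤ M₀ := fun j τ hτ y =>
      (hbdd _ τ ⟨(hAu j).trans hτ.1, hτ.2.trans ht⟩ y).trans
        (div_sqrt_neg_le hC.le (neg_pos.2 ht) (by linarith [hτ.2]))
    -- measurability
    have hum : ∀ j, AEStronglyMeasurable (uncurry (u j))
        ((volume : Measure (ℝ × (EuclideanSpace ℝ (Fin 3)))).restrict (Ioo s t ×ˢ univ)) := fun j =>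
      ((hcont _).mono (prod_mono (fun τ hτ => ⟨(hAu j).trans hτ.1, (hτ.2.trans ht).trans (hBpos _)⟩)
        Subset.rfl)).aestronglyMeasurable (measurableSet_Ioo.prod MeasurableSet.univ)
    have hWm : AEStronglyMeasurable (uncurry W) ((volume : Measure (ℝ × (EuclideanSpace ℝ (Fin 3)))).restrict (Ioo s t ×ˢ univ)) :=
      (hWc.mono (prod_mono (fun τ hτ => hτ.2.trans ht) Subset.rfl)).aestronglyMeasurable
        (measurableSet_Ioo.prod MeasurableSet.univ)
    -- pointwise convergence along the shifted subsequence
    have hptu : ∀ τ < 0, ∀ y, Tendsto (fun j => u j τ y) atTop (𝓝 (W τ y)) := fun τ hτ y =>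
      (hpt τ hτ y).comp hshift
    -- the Duhamel term
    have hD : Tendsto (fun j => oseenDuhamel 1 s (u j) (u j) t x) atTop (𝓝 (oseenDuhamel 1 s W W t x)) :=
      tendsto_oseenDuhamel_of_tendsto_of_bound one_pos hM₀0 hst hum hWm huM
        (fun τ hτ y => hptu τ (hτ.2.trans ht) y) x
    -- the caloric term
    have hH : Tendsto (fun j => UnboundedOperators.heatExtension (u j s) (t - s) x) atTop
        (𝓝 (UnboundedOperators.heatExtension (W s) (t - s) x)) := by
      refine tendsto_heatExtension_of_tendsto_of_bound (M := C / Real.sqrt (-s))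
        (fun j => (hslice _ s ⟨hAu j, hs0.trans (hBpos _)⟩).aestronglyMeasurable)
        (fun j z => hbdd _ s ⟨hAu j, hs0⟩ z) (hptu s hs0) (sub_pos.2 hst) x
    -- the identity for each `j` and the limit
    have hid : (fun j => u j t x) = fun j =>
        UnboundedOperators.heatExtension (u j s) (t - s) x - oseenDuhamel 1 s (u j) (u j) t x :=
      funext fun j => hmild _ s t (hAu j) hst ht x
    have hlim2 : Tendsto (fun j => u j t x) atTop
        (𝓝 (UnboundedOperators.heatExtension (W s) (t - s) x - oseenDuhamel 1 s W W t x)) := by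
      rw [hid]; exact hH.sub hD
    exact tendsto_nhds_unique (hptu t ht x) hlim2
  · -- ## Step 3': slice-wise locally uniform convergence
    exact tendstoLocallyUniformly_slice_of_tendstoUniformlyOn_slabPiece hW₀ ht

end Literature.Analysis.FluidPDE

end
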